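import Summits.Ventures.PercRepro.C041ThreeExitCountB
import Summits.Ventures.PercRepro.C041TwoExitSix

/-!
# ROW C-041 — THE THREE-EXIT BLOCK MAP: the contribution of one colouring, the fibre vector, and the six-vector as
the sum of the fibre vectors (p6, gen 31)

Setting of `C041ThreeExitCount` / `C041ThreeExitCountB` and the exit vectors of `C041TwoExitSix`.  THE CONTRIBUTION
of a colouring of the multigraph with three exits (`contrib3`) by the statuses — `x`, `x'`, `x''` the per-exit
vectors (`exitOf`): the product of the `x`'s of the merged exits, times, for every block of separated exits sharing
one blue sub-zone, `θ_R` of the product of its members' `x`'s (a separated exit alone: `θ_R x`).  THE FIBRE VECTOR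
over a colouring (`fibVec3`: the six fibre counts), and **`sixVec_eq_sum_fibVec3`**: `Π(glue3) = ∑_ω fibVec3 ω`.
The identification `fibVec3 ω = contrib3 (statuses of ω)` and THEOREM (THREE-EXIT BLOCK MAP) are in
`C041ThreeExitMain`.
-/

namespace PercRepro

namespace ZoneZ

namespace TwoExit

open ZoneData TreeClosure Finset

open Classical in
/-- **The contribution of one colouring** of a multigraph with three exits, by the statuses (`mg` / `mg'` / `mg''`
merged, `rd` / `rd'` / `rd''` reached, `bc` = `u ~ u'`, `bc'` = `u'' ~ u'`, `bc''` = `u'' ~ u` blue-connected):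
with `x = exitOf w rd` etc., the product of the merged exits' vectors times `θ_R` of the product of each block of
separated exits. -/
noncomputable def contrib3 (w w' w'' : Vec6) (mg rd mg' rd' mg'' rd'' bc bc' bc'' : Prop) : Vec6 :=
  if mg then
    (if mg' then
      (if mg'' then exitOf w rd * exitOf w' rd' * exitOf w'' rd''
        else exitOf w rd * exitOf w' rd' * thR (exitOf w'' rd''))
    else
      (if mg'' then exitOf w rd * thR (exitOf w' rd') * exitOf w'' rd''
        else (if bc' then exitOf w rd * thR (exitOf w' rd' * exitOf w'' rd'')
          else exitOf w rd * thR (exitOf w' rd') * thR (exitOf w'' rd''))))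
  else
    (if mg' then
      (if mg'' then thR (exitOf w rd) * exitOf w' rd' * exitOf w'' rd''
        else (if bc'' then thR (exitOf w rd * exitOf w'' rd'') * exitOf w' rd'
          else thR (exitOf w rd) * exitOf w' rd' * thR (exitOf w'' rd'')))
    else
      (if mg'' then
        (if bc then thR (exitOf w rd * exitOf w' rd') * exitOf w'' rd''
          else thR (exitOf w rd) * thR (exitOf w' rd') * exitOf w'' rd'')
      else
        (if bc then
          (if bc' then thR (exitOf w rd * exitOf w' rd' * exitOf w'' rd'')
            else thR (exitOf w rd * exitOf w' rd') * thR (exitOf w'' rd''))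
        else
          (if bc'' then thR (exitOf w rd * exitOf w'' rd'') * thR (exitOf w' rd')
            else (if bc' then thR (exitOf w rd) * thR (exitOf w' rd' * exitOf w'' rd'')
              else thR (exitOf w rd) * thR (exitOf w' rd') * thR (exitOf w'' rd''))))))

variable {V₁ E₁ U₁ U₂ V E T₁ T₂ V' E' T₁' T₂' V'' E'' T₁'' T₂'' : Type}
variable (Z₁ : ZoneData V₁ E₁ U₁ U₂) (u u' u'' : V₁) (Z : ZoneData V E T₁ T₂) (a : V)
  (Z' : ZoneData V' E' T₁' T₂') (a' : V') (Z'' : ZoneData V'' E'' T₁'' T₂'') (a'' : V'') (a₁ : V₁)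
variable [Fintype E₁] [DecidableEq E₁] [Fintype E] [DecidableEq E] [Fintype T₁] [DecidableEq T₁]
  [Fintype T₂] [DecidableEq T₂] [Fintype E'] [DecidableEq E'] [Fintype T₁'] [DecidableEq T₁']
  [Fintype T₂'] [DecidableEq T₂'] [Fintype E''] [DecidableEq E''] [Fintype T₁''] [DecidableEq T₁'']
  [Fintype T₂''] [DecidableEq T₂'']

/-- The six fibre counts over a colouring `ω` of `Z₁`. -/
noncomputable def fibVec3 (ω : E₁ → Bool) : Vec6 :=
  ![(#(fib3 Z₁ u u' u'' Z a Z' a' Z'' a'' a₁ ω true true false) : ℝ),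
    #(fib3 Z₁ u u' u'' Z a Z' a' Z'' a'' a₁ ω false true false),
    #(fib3 Z₁ u u' u'' Z a Z' a' Z'' a'' a₁ ω true false false),
    #(fib3 Z₁ u u' u'' Z a Z' a' Z'' a'' a₁ ω true true true),
    #(fib3 Z₁ u u' u'' Z a Z' a' Z'' a'' a₁ ω false true true),
    #(fib3 Z₁ u u' u'' Z a Z' a' Z'' a'' a₁ ω true false true)]

/-- A filter on the states of the attachment, as a filter on quadruples. -/
theorem card_filter_eq3 (Q : State (((E₁ ⊕ E') ⊕ E) ⊕ E'') ((T₁' ⊕ T₁) ⊕ T₁'') ((T₂' ⊕ T₂) ⊕ T₂'') → Prop)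
    (Q' : (E₁ → Bool) × State E' T₁' T₂' × State E T₁ T₂ × State E'' T₁'' T₂'' → Prop) [DecidablePred Q]
    [DecidablePred Q'] (h : ∀ σ, Q σ ↔ Q' (col₁₃ σ, st'₃ σ, st₃ σ, st''₃ σ)) :
    #(univ.filter Q) = #(univ.filter Q') := by
  refine Finset.card_equiv (stateEquiv3 (E₁ := E₁) (E := E) (T₁ := T₁) (T₂ := T₂) (E' := E') (T₁' := T₁')
    (T₂' := T₂') (E'' := E'') (T₁'' := T₁'') (T₂'' := T₂'')) fun σ => ?_
  rw [Finset.mem_filter, Finset.mem_filter]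
  simp only [Finset.mem_univ, true_and, stateEquiv3_apply]
  exact h σ

omit [Fintype E₁] [DecidableEq E₁] in
/-- A fibre is the filter of its condition on triples (with any decidability instance). -/
theorem fib3_eq_filter (ω : E₁ → Bool) (c1 c2 k : Bool)
    [DecidablePred fun p : State E' T₁' T₂' × State E T₁ T₂ × State E'' T₁'' T₂'' =>
      fibCond3 Z₁ u u' u'' Z a Z' a' Z'' a'' a₁ ω c1 c2 k p.1 p.2.1 p.2.2] :
    fib3 Z₁ u u' u'' Z a Z' a' Z'' a'' a₁ ω c1 c2 k =
      univ.filter fun p : State E' T₁' T₂' × State E T₁ T₂ × State E'' T₁'' T₂'' =>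
        fibCond3 Z₁ u u' u'' Z a Z' a' Z'' a'' a₁ ω c1 c2 k p.1 p.2.1 p.2.2 := by
  ext p
  rw [mem_fib3, Finset.mem_filter]
  exact (and_iff_right (Finset.mem_univ _)).symm

/-- One count of the attachment, as the sum over the colourings of the fibre counts. -/
theorem card_eq_sum_card_fib3 (S : Finset (State (((E₁ ⊕ E') ⊕ E) ⊕ E'') ((T₁' ⊕ T₁) ⊕ T₁'') ((T₂' ⊕ T₂) ⊕ T₂'')))
    (c1 c2 k : Bool)
    (h : ∀ σ, σ ∈ S ↔ fibCond3 Z₁ u u' u'' Z a Z' a' Z'' a'' a₁ (col₁₃ σ) c1 c2 k (st'₃ σ) (st₃ σ) (st''₃ σ)) :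
    #S = ∑ ω : E₁ → Bool, #(fib3 Z₁ u u' u'' Z a Z' a' Z'' a'' a₁ ω c1 c2 k) := by
  classical
  have e : S = univ.filter fun σ =>
      fibCond3 Z₁ u u' u'' Z a Z' a' Z'' a'' a₁ (col₁₃ σ) c1 c2 k (st'₃ σ) (st₃ σ) (st''₃ σ) := by
    ext σ
    rw [h, Finset.mem_filter]
    exact (and_iff_right (Finset.mem_univ _)).symm
  rw [e, card_filter_eq3 _ (fun p : (E₁ → Bool) × State E' T₁' T₂' × State E T₁ T₂ × State E'' T₁'' T₂'' =>
    fibCond3 Z₁ u u' u'' Z a Z' a' Z'' a'' a₁ p.1 c1 c2 k p.2.1 p.2.2.1 p.2.2.2) (fun _ => Iff.rfl),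
    card_filter_prod_eq_sum]
  refine Finset.sum_congr rfl fun ω _ => ?_
  rw [fib3_eq_filter]

/-- **The six-vector of the three-exit attachment is the sum of the fibre vectors.** -/
theorem sixVec_eq_sum_fibVec3 :
    (glue3 Z₁ u u' u'' Z a Z' a' Z'' a'').sixVec (Sum.inl (Sum.inl (Sum.inl a₁))) =
      ∑ ω : E₁ → Bool, fibVec3 Z₁ u u' u'' Z a Z' a' Z'' a'' a₁ ω := by
  refine vec6_ext _ _ ?_ ?_ ?_ ?_ ?_ ?_
  · rw [Finset.sum_apply, sixVec_zero,
      card_eq_sum_card_fib3 Z₁ u u' u'' Z a Z' a' Z'' a'' a₁ _ true true false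
        (mem_Fset_iff3 Z₁ u u' u'' Z a Z' a' Z'' a'' a₁)]
    push_cast
    simp only [fibVec3, Matrix.cons_val]
  · rw [Finset.sum_apply, sixVec_one,
      card_eq_sum_card_fib3 Z₁ u u' u'' Z a Z' a' Z'' a'' a₁ _ false true false
        (mem_FAset_iff3 Z₁ u u' u'' Z a Z' a' Z'' a'' a₁)]
    push_cast
    simp only [fibVec3, Matrix.cons_val]
  · rw [Finset.sum_apply, sixVec_two,
      card_eq_sum_card_fib3 Z₁ u u' u'' Z a Z' a' Z'' a'' a₁ _ true false false
        (mem_FBset_iff3 Z₁ u u' u'' Z a Z' a' Z'' a'' a₁)]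
    push_cast
    simp only [fibVec3, Matrix.cons_val]
  · rw [Finset.sum_apply, sixVec_three,
      card_eq_sum_card_fib3 Z₁ u u' u'' Z a Z' a' Z'' a'' a₁ _ true true true
        (mem_IFset_iff3 Z₁ u u' u'' Z a Z' a' Z'' a'' a₁)]
    push_cast
    simp only [fibVec3, Matrix.cons_val]
  · rw [Finset.sum_apply, sixVec_four,
      card_eq_sum_card_fib3 Z₁ u u' u'' Z a Z' a' Z'' a'' a₁ _ false true true
        (mem_IAset_iff3 Z₁ u u' u'' Z a Z' a' Z'' a'' a₁)]
    push_cast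
    simp only [fibVec3, Matrix.cons_val]
  · rw [Finset.sum_apply, sixVec_five,
      card_eq_sum_card_fib3 Z₁ u u' u'' Z a Z' a' Z'' a'' a₁ _ true false true
        (mem_IBset_iff3 Z₁ u u' u'' Z a Z' a' Z'' a'' a₁)]
    push_cast
    simp only [fibVec3, Matrix.cons_val]

end TwoExit

end ZoneZ

end PercRepro
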